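import Summits.KontsevichZagierPeriods.KontsevichZagierPeriods.Theses.FermatIsogeny
import Summits.KontsevichZagierPeriods.KontsevichZagierPeriods.Theorems.TerasomaMultiplicationTriplicationFromMultiplication

/-!
# `TriplicationGlue` (stmt-KontsevichZagierPeriods-3901): the glue of the 0312 certificate

Route `FermatIsogeny`, support item #9:
`IsogenyLinearNinth → DirichletNinth → ReflectionNinth → TriplicationAccessible`.
The Gauss-triplication pair 0312,
`r = [(0,1)², x^{-8/9}(1-x)^{-5/9}·y^{-4/9}(1-y)^{-2/9}] ∼ r' = [{x²+y²<4}, 3^{7/6}/2]`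
(`B(1/9,4/9)·B(5/9,7/9) = 2·3^{7/6}·π`), follows from the three dimension-≤-2 antecedents of the route
by the PROVED product/ideal structure of `KZ.relations` (`KZProductIdeal.lean`: `Equivalent.prod`;
scaling `KZ.IntegralRep.constMul` / `Equivalent.constMul` of `KZRelationsLE.lean`) — no new move is
made in this file except through the already-landed helper lemmas of the sibling glue
`TerasomaMultiplication.TriplicationGlue` (congruence of integrands on the domain, the null unit
circle `[π] ∼ [open unit disc, 1]`, and the scaling `z ↦ 2z` onto the disc of radius `2`).

The derivation (`β(a,b) = [(0,1), t^{a-1}(1-t)^{b-1}] = KZ.IntegralRep.ofMellin (X₀, 1−X₀) (a−1,b−1) 1`,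
`c = (8/3)·3^{1/6}·sin(π/9)`, `s = sin(π/9)`):
1. `r ∼ β(1/9,4/9) × β(5/9,7/9)` (same domain, integrands agree on it);
2. `IsogenyLinearNinth`: `β(5/9,7/9) ∼ c·β(8/9,5/9)`, hence `r ∼ c·(β(1/9,4/9) × β(8/9,5/9))`;
3. `DirichletNinth`: `β(1/9,4/9) × β(8/9,5/9) ∼ (9/4)·β(1/9,8/9)`, hence `r ∼ (9c/4)·β(1/9,8/9)`;
4. `ReflectionNinth`: `s·β(1/9,8/9) ∼ [π]`, hence `β(1/9,8/9) ∼ s⁻¹·[π]` and `r ∼ (9c/(4s))·[π]`;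
5. `9c/(4s) = 6·3^{1/6} = 2·3^{7/6}` and `2·3^{7/6}·[π] ∼ r'` (`piRep_const_equiv_target`).

References: M. Kontsevich, D. Zagier, *Periods* (2001), §1.1–1.2, §4.1; N. Koblitz, D. Rohrlich,
*Simple factors in the Jacobian of a Fermat curve* (1978), Thm. 3 (the isogeny behind step 2);
G. Andrews, R. Askey, R. Roy, *Special Functions* (1999), Thm. 1.8.1 (Dirichlet, step 3).
Nothing about the antecedents themselves is proved here. No notation and no definition is
introduced: the Beta representations are written `KZ.IntegralRep.ofMellin _ _ _ h`, the family
`(X₀, 1−X₀)`, the exponents and the constant `1` being read off the convergence proof `h`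
(`TriplicationGlue.integrableOn_beta`).
-/

noncomputable section

-- the sub-problem namespace `KontsevichZagierPeriods.KontsevichZagierPeriods` is the tree's layout (D-0017)
set_option linter.dupNamespace false

open MeasureTheory Set
open Literature.NumberTheory.Transcendental
open Literature.NumberTheory.Transcendental.KZ
open Summit.KontsevichZagierPeriods.KontsevichZagierPeriods.BetaCancellationNegative (betaKernel)
open Summit.KontsevichZagierPeriods.TerasomaMultiplication.TriplicationGlue
  (integrableOn_beta prod_beta_domain prod_beta_integrand mellinBox_bF_eq_setOf mellinIntegrand_bF
    prod_congr_right prod_constMul_eq constMul_constMul_eq constMul_congr equivalent_constMul_inv_of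
    isAlgebraic_kappa piRep_const_equiv_target)

namespace Summit.KontsevichZagierPeriods.KontsevichZagierPeriods.Theorems

namespace FermatIsogenyTriplicationGlue

/-! ## The constants `sin(π/9)`, `c = (8/3)·3^{1/6}·sin(π/9)`, `9/4` -/

/-- `sin(π/9)` is algebraic. [folklore] -/
theorem isAlgebraic_sin_pi_div_nine : IsAlgebraic ℚ (Real.sin (Real.pi / 9)) := by
  have h := KoblitzOgus.isAlgebraic_sin_rat_mul_pi 1 (b := 9) (by norm_num)
  simpa using h

/-- `0 < sin(π/9)`. [folklore] -/
theorem sin_pi_div_nine_pos : 0 < Real.sin (Real.pi / 9) :=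
  Real.sin_pos_of_pos_of_lt_pi (by positivity) (by linarith [Real.pi_pos])

/-- `sin(π/9) ≠ 0`. [folklore] -/
theorem sin_pi_div_nine_ne_zero : Real.sin (Real.pi / 9) ≠ 0 := sin_pi_div_nine_pos.ne'

/-- `3^{1/6}` is algebraic. [folklore] -/
theorem isAlgebraic_three_rpow_sixth : IsAlgebraic ℚ ((3:ℝ) ^ ((1:ℝ) / 6)) := by
  have h := KoblitzOgus.isAlgebraic_nat_rpow_rat (m := 3) (by norm_num) 1 (q := 6) (by norm_num)
  have e : (3:ℝ) ^ ((1:ℝ) / 6) = ((3:ℕ):ℝ) ^ (((1:ℤ):ℝ) / ((6:ℕ):ℝ)) := by push_cast; norm_num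
  rw [e]
  exact h

/-- `8/3` is algebraic. [folklore] -/
theorem isAlgebraic_eight_div_three : IsAlgebraic ℚ (8 / 3 : ℝ) := by
  have h : IsAlgebraic ℚ ((8 / 3 : ℚ) : ℝ) := isAlgebraic_algebraMap _
  have e : ((8 / 3 : ℚ) : ℝ) = (8 / 3 : ℝ) := by push_cast; ring
  rwa [e] at h

/-- `9/4` is algebraic. [folklore] -/
theorem isAlgebraic_nine_div_four : IsAlgebraic ℚ (9 / 4 : ℝ) := by
  have h : IsAlgebraic ℚ ((9 / 4 : ℚ) : ℝ) := isAlgebraic_algebraMap _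
  have e : ((9 / 4 : ℚ) : ℝ) = (9 / 4 : ℝ) := by push_cast; ring
  rwa [e] at h

/-- **The isogeny constant is algebraic**: `c = (8/3)·3^{1/6}·sin(π/9)` (the multiplier of
`IsogenyLinearNinth`, `B(5/9,7/9) = c·B(8/9,5/9)`). [folklore] -/
theorem isAlgebraic_isoConst :
    IsAlgebraic ℚ ((8 / 3 : ℝ) * (3:ℝ) ^ ((1:ℝ) / 6) * Real.sin (Real.pi / 9)) :=
  (isAlgebraic_eight_div_three.mul isAlgebraic_three_rpow_sixth).mul isAlgebraic_sin_pi_div_nine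

/-- **Bookkeeping of the constant**: `c · (9/4) · sin(π/9)⁻¹ = 2·3^{7/6}`
(`(8/3)(9/4) = 6`, `6·3^{1/6} = 2·3^{7/6}`). [folklore] -/
theorem isoConst_bookkeeping :
    (8 / 3 : ℝ) * (3:ℝ) ^ ((1:ℝ) / 6) * Real.sin (Real.pi / 9) * (9 / 4) * (Real.sin (Real.pi / 9))⁻¹ =
      2 * (3:ℝ) ^ ((7:ℝ) / 6) := by
  have h7 : (3:ℝ) ^ ((7:ℝ) / 6) = 3 * (3:ℝ) ^ ((1:ℝ) / 6) := by
    rw [show (7:ℝ) / 6 = 1 + 1 / 6 by norm_num, Real.rpow_add (by norm_num : (0:ℝ) < 3), Real.rpow_one]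
  rw [h7]
  field_simp [sin_pi_div_nine_ne_zero]
  ring

end FermatIsogenyTriplicationGlue

open FermatIsogenyTriplicationGlue

/-- **`TriplicationGlue`** (stmt-KontsevichZagierPeriods-3901):
`IsogenyLinearNinth → DirichletNinth → ReflectionNinth → TriplicationAccessible`, the glue of the
0312 certificate of route FermatIsogeny, by the product/ideal structure of `KZ.relations`
(congruence on the domain, `Equivalent.prod`, algebraic scalars through products and across
equivalences, the null unit circle and the scaling `z ↦ 2z`); see the module docstring for the
five-step derivation. [folklore] -/
theorem triplicationGlue_proof :
    Summit.KontsevichZagierPeriods.KontsevichZagierPeriods.Theses.FermatIsogeny.TriplicationGlue := by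
  intro hI hD hR r r' hr hri hr' hri'
  -- convergence of the four Beta integrals of the derivation (`β(a,b) = IntegralRep.ofMellin _ _ _ cab`)
  have c19_49 := integrableOn_beta (a := 1 / 9) (b := 4 / 9) (by norm_num) (by norm_num)
  have c59_79 := integrableOn_beta (a := 5 / 9) (b := 7 / 9) (by norm_num) (by norm_num)
  have c89_59 := integrableOn_beta (a := 8 / 9) (b := 5 / 9) (by norm_num) (by norm_num)
  have c19_89 := integrableOn_beta (a := 1 / 9) (b := 8 / 9) (by norm_num) (by norm_num)
  have hc := isAlgebraic_isoConst
  have hs := isAlgebraic_sin_pi_div_nine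
  have hq := isAlgebraic_nine_div_four
  -- the casts of the exponents
  have x19 : (((1 / 9 : ℚ) : ℝ) - 1) = -(8:ℝ) / 9 := by push_cast; norm_num
  have x49 : (((4 / 9 : ℚ) : ℝ) - 1) = -(5:ℝ) / 9 := by push_cast; norm_num
  have x59 : (((5 / 9 : ℚ) : ℝ) - 1) = -(4:ℝ) / 9 := by push_cast; norm_num
  have x79 : (((7 / 9 : ℚ) : ℝ) - 1) = -(2:ℝ) / 9 := by push_cast; norm_num
  have x89 : (((8 / 9 : ℚ) : ℝ) - 1) = -(1:ℝ) / 9 := by push_cast; norm_num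
  -- Step 1: `r ∼ β(1/9,4/9) × β(5/9,7/9)` (same domain, integrands agree on it)
  have e0 : Equivalent r ((IntegralRep.ofMellin _ _ _ c19_49).prod (IntegralRep.ofMellin _ _ _ c59_79)) := by
    refine of_sub_of_mem_relations_of_eqOn ?_ fun x hx => ?_
    · rw [prod_beta_domain, hr]
      ext x
      simp only [mem_setOf_eq, Fin.forall_fin_two]
    · rw [prod_beta_integrand, hri hx]
      simp only [betaKernel]
      rw [x19, x49, x59, x79]
      ring
  -- Step 2: `IsogenyLinearNinth`, Beta form: `β(5/9,7/9) ∼ c·β(8/9,5/9)`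
  have hI' : Equivalent (IntegralRep.ofMellin _ _ _ c59_79) ((IntegralRep.ofMellin _ _ _ c89_59).constMul _ hc) := by
    refine hI _ _ ?_ (fun x _ => ?_) ?_ (fun x _ => ?_)
    · rw [IntegralRep.ofMellin_domain, mellinBox_bF_eq_setOf]
    · rw [IntegralRep.ofMellin_integrand, mellinIntegrand_bF]
      simp only [betaKernel]
      rw [x59, x79]
    · rw [IntegralRep.domain_constMul, IntegralRep.ofMellin_domain, mellinBox_bF_eq_setOf]
    · rw [IntegralRep.integrand_constMul]
      dsimp only
      rw [IntegralRep.ofMellin_integrand, mellinIntegrand_bF]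
      simp only [betaKernel]
      rw [x89, x59]
      ring
  -- … applied to the second factor, the scalar pulled out of the product
  have e1 : Equivalent r
      (((IntegralRep.ofMellin _ _ _ c19_49).prod (IntegralRep.ofMellin _ _ _ c89_59)).constMul _ hc) := by
    have h := e0.trans (prod_congr_right _ hI')
    rwa [prod_constMul_eq] at h
  -- Step 3: `DirichletNinth`, Beta form: `β(1/9,4/9) × β(8/9,5/9) ∼ (9/4)·β(1/9,8/9)`
  have hD' : Equivalent ((IntegralRep.ofMellin _ _ _ c19_49).prod (IntegralRep.ofMellin _ _ _ c89_59))
      ((IntegralRep.ofMellin _ _ _ c19_89).constMul _ hq) := by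
    refine hD _ _ ?_ (fun x _ => ?_) ?_ (fun x _ => ?_)
    · rw [prod_beta_domain]
      ext x
      simp only [mem_setOf_eq, Fin.forall_fin_two]
    · rw [prod_beta_integrand]
      simp only [betaKernel]
      rw [x19, x49, x89, x59]
      ring
    · rw [IntegralRep.domain_constMul, IntegralRep.ofMellin_domain, mellinBox_bF_eq_setOf]
    · rw [IntegralRep.integrand_constMul]
      dsimp only
      rw [IntegralRep.ofMellin_integrand, mellinIntegrand_bF]
      simp only [betaKernel]
      rw [x19, x89]
      ring
  -- … scaled by `c`
  have e2 : Equivalent r ((IntegralRep.ofMellin _ _ _ c19_89).constMul _ (hc.mul hq)) := by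
    have h := e1.trans (hD'.constMul _ hc)
    rwa [constMul_constMul_eq] at h
  -- Step 4: `ReflectionNinth`, Beta form: `sin(π/9)·β(1/9,8/9) ∼ [π]` (`KZ.piRep`)
  have hR' : Equivalent ((IntegralRep.ofMellin _ _ _ c19_89).constMul _ hs) piRep := by
    refine hR _ piRep ?_ (fun x _ => ?_) rfl fun _ _ => rfl
    · rw [IntegralRep.domain_constMul, IntegralRep.ofMellin_domain, mellinBox_bF_eq_setOf]
    · rw [IntegralRep.integrand_constMul]
      dsimp only
      rw [IntegralRep.ofMellin_integrand, mellinIntegrand_bF]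
      simp only [betaKernel]
      rw [x19, x89, mul_assoc]
  -- … inverted and scaled by `9c/4`
  have e3 : Equivalent (IntegralRep.ofMellin _ _ _ c19_89) (piRep.constMul _ hs.inv) :=
    equivalent_constMul_inv_of hs sin_pi_div_nine_ne_zero hR'
  have e4 : Equivalent r (piRep.constMul _ ((hc.mul hq).mul hs.inv)) := by
    have h := e2.trans (e3.constMul _ (hc.mul hq))
    rwa [constMul_constMul_eq] at h
  -- Step 5: `9c/(4 sin(π/9)) = 2·3^{7/6}` and the target pair
  rw [constMul_congr _ _ isAlgebraic_kappa isoConst_bookkeeping] at e4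
  exact e4.trans (piRep_const_equiv_target isAlgebraic_kappa r' hr' hri')

end Summit.KontsevichZagierPeriods.KontsevichZagierPeriods.Theorems
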